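import Summits.ResolutionOfSingularities.ResolutionOfSingularities.Theorems.FrobeniusLadderFRationalResolutionIntegralHeight
import Mathlib.Order.KrullDimension
import HarnessLib

/-!
# Crux `FrobeniusLadder.FRationalResolution` (stmt-ResolutionOfSingularities-15317), line `redirect`,
# stub `stub_diagonalizableQuotientResolution` — along an injective integral extension every prime has
# a prime OVER it of the SAME height (going-up along a maximal chain; item (C3) of the packaging step,
# memo MEMO-15317-leafhand2-g3 §8)

Kato's condition (2.1)(ii) on the invariant neighbourhood compares `dim (S₀)_𝔮'` with `dim S_𝔔'` for a
prime `𝔔'` of `S` over `𝔮'`; condition (i) holds for EVERY such `𝔔'` (`…StratumDescentGradeZero`),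
so one may CHOOSE `𝔔'` with `ht 𝔔' = ht 𝔮'`. Such a prime exists for any injective integral
extension of Noetherian rings, without going-down: lift a chain of primes of maximal length below
`𝔮'` by going-up (`Ideal.exists_ideal_over_prime_of_isIntegral`), and bound the other way by
incomparability (`…IntegralHeight.height_map_quotient_eq_zero_of_isIntegral` with Mathlib's
`Ideal.height_le_height_add_of_liesOver`).

* `exists_liesOver_le_height` — for every `n ≤ ht p` there is a prime `Q` over `p` with `n ≤ ht Q`;
* **`exists_liesOver_height_eq`** — there is a prime `Q` over `p` with `ht Q = ht p`;
* **`exists_liesOver_ringKrullDim_eq`** — hence `dim S_Q = dim R_p` for some `Q` over `p`.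

Honest label: generic commutative-algebra brick (no stub closed). No definitions, no named facts,
no sorry. [cite: Matsumura1987, Thm. 9.4] [cite: StacksProject, Tag 00ON]
-/

noncomputable section

-- single-problem summit: the doubled namespace component is forced
set_option linter.dupNamespace false

namespace Summit.ResolutionOfSingularities.ResolutionOfSingularities.Theorems.FRationalResolution.GoingUpHeight

universe u v

variable {R : Type u} {S : Type v} [CommRing R] [CommRing S] [Algebra R S]

/-- **Going up along chains**: for an integral extension `R → S` with injective structure map, every
prime `p` of `R` and every `n ≤ ht p`, there is a prime `Q` of `S` lying over `p` with `n ≤ ht Q`.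
[cite: Matsumura1987, Thm. 9.4] -/
theorem exists_liesOver_le_height [Algebra.IsIntegral R S]
    (hinj : Function.Injective (algebraMap R S)) :
    ∀ (n : ℕ) (p : Ideal R) [p.IsPrime], (n : ℕ∞) ≤ p.height →
      ∃ Q : Ideal S, Q.IsPrime ∧ Q.comap (algebraMap R S) = p ∧ (n : ℕ∞) ≤ Q.height := by
  intro n
  induction n with
  | zero =>
    intro p _ _
    obtain ⟨Q, -, hQ, hQp⟩ := Ideal.exists_ideal_over_prime_of_isIntegral p (⊥ : Ideal S) (by
      intro r hr
      rw [Ideal.mem_comap, Ideal.mem_bot] at hr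
      have : r = 0 := hinj (by rw [hr, map_zero])
      rw [this]; exact p.zero_mem)
    exact ⟨Q, hQ, hQp, by simp⟩
  | succ n ih =>
    intro p _ hn
    -- a chain of length `n+1` below `p`: its penultimate member `p'` has `n ≤ ht p'`, `p' < p`
    have hn' : ((n + 1 : ℕ) : ℕ∞) ≤ Order.height (⟨p, ‹_›⟩ : PrimeSpectrum R) := by
      rw [← PrimeSpectrum.height_eq_orderHeight]; exact hn
    obtain ⟨l, hlast, hlen⟩ := Order.exists_series_of_le_height _ hn'
    have hl0 : l.length ≠ 0 := by rw [hlen]; exact Nat.succ_ne_zero n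
    set q : PrimeSpectrum R := l.eraseLast.last with hq
    have hqp : q < ⟨p, ‹_›⟩ := by
      rw [← hlast]; exact l.eraseLast_last_rel_last hl0
    have hqn : (n : ℕ∞) ≤ q.asIdeal.height := by
      rw [PrimeSpectrum.height_eq_orderHeight]
      have h := Order.length_le_height_last (p := l.eraseLast)
      have hlen' : l.eraseLast.length = n := by
        simp only [RelSeries.eraseLast_length, hlen]; rfl
      rw [hlen'] at h
      exact h
    haveI := q.isPrime
    obtain ⟨Q', hQ'prime, hQ'q, hQ'n⟩ := ih q.asIdeal hqn
    haveI := hQ'prime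
    -- go up from `Q'` over `q` to a prime over `p`
    have hle : Q'.comap (algebraMap R S) ≤ p := by
      rw [hQ'q]; exact (le_of_lt hqp :)
    obtain ⟨Q, hQQ', hQprime, hQp⟩ :=
      Ideal.exists_ideal_over_prime_of_isIntegral_of_isPrime p Q' hle
    haveI := hQprime
    have hlt : Q' < Q := by
      refine lt_of_le_of_ne hQQ' fun h => ?_
      have : q.asIdeal = p := by rw [← hQ'q, h, hQp]
      exact (ne_of_lt hqp) (PrimeSpectrum.ext this)
    refine ⟨Q, hQprime, hQp, ?_⟩
    calc ((n + 1 : ℕ) : ℕ∞) = (n : ℕ∞) + 1 := by push_cast; rfl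
      _ ≤ Q'.height + 1 := by gcongr
      _ ≤ Q.height := Ideal.height_add_one_le_of_lt_of_isPrime hlt

/-- **A prime over `p` of the same height** (injective integral extension of Noetherian rings).
[cite: Matsumura1987, Thm. 9.4] [cite: StacksProject, Tag 00ON] -/
theorem exists_liesOver_height_eq [IsNoetherianRing R] [IsNoetherianRing S] [Algebra.IsIntegral R S]
    (hinj : Function.Injective (algebraMap R S)) (p : Ideal R) [p.IsPrime] :
    ∃ Q : Ideal S, Q.IsPrime ∧ Q.comap (algebraMap R S) = p ∧ Q.height = p.height := by
  have hfin : p.height ≠ ⊤ := Ideal.height_ne_top (Ideal.IsPrime.ne_top ‹_›)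
  obtain ⟨n, hn⟩ := ENat.ne_top_iff_exists.mp hfin
  obtain ⟨Q, hQ, hQp, hnQ⟩ := exists_liesOver_le_height hinj n p (by rw [← hn])
  haveI := hQ
  haveI : Q.LiesOver p := ⟨by rw [Ideal.under_def, hQp]⟩
  refine ⟨Q, hQ, hQp, le_antisymm ?_ (hn ▸ hnQ)⟩
  have h := Ideal.height_le_height_add_of_liesOver p Q
  rwa [IntegralHeight.height_map_quotient_eq_zero_of_isIntegral p Q, add_zero] at h

/-- Hence **`dim S_Q = dim R_p` for some prime `Q` over `p`**. [cite: Matsumura1987, Thm. 9.4] -/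
theorem exists_liesOver_ringKrullDim_eq [IsNoetherianRing R] [IsNoetherianRing S]
    [Algebra.IsIntegral R S] (hinj : Function.Injective (algebraMap R S)) (p : Ideal R) [p.IsPrime] :
    ∃ (Q : Ideal S) (_ : Q.IsPrime), Q.comap (algebraMap R S) = p ∧
      ringKrullDim (Localization.AtPrime Q) = ringKrullDim (Localization.AtPrime p) := by
  obtain ⟨Q, hQ, hQp, hh⟩ := exists_liesOver_height_eq hinj p
  haveI := hQ
  refine ⟨Q, hQ, hQp, ?_⟩
  rw [IsLocalization.AtPrime.ringKrullDim_eq_height Q (Localization.AtPrime Q),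
    IsLocalization.AtPrime.ringKrullDim_eq_height p (Localization.AtPrime p), hh]

end Summit.ResolutionOfSingularities.ResolutionOfSingularities.Theorems.FRationalResolution.GoingUpHeight

end
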